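import Mathlib
import Summits.Ventures.PercRepro2.Graph
import Summits.Ventures.PercRepro2.RootLeafUPocketGraph

/-!
# The boundary-`{u, a₂, c}` pocket at `b`: the one-excursion closure theorem (blind cell PercRepro2,
p4 g18; S3 (G4-u) item (ae), proofs/P4-G18-PDTHRESHOLD.md §6; pure combinatorics, no definitions)

A **pocket** `P ⊆ V` at the mark `b` with **terminal set** `{u, a₂, c}` (`u, a₂, c ∉ P`): every edge
touching `P` has both endpoints in `P ∪ {u, a₂, c}` (`hP`).  As in RootLeafUPocketGraph the
configuration `ω` is split into an outside part `off ω` (pocket edges closed) and a pocket part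
`inn ω` (the other edges closed), characterised by `hoff` / `hinn`.  Unlike the root-only pocket,
the pocket part MAY join terminals (`c ~ a₂`, `c ~ u`, `u ~ a₂`), so outside connections are not
`P`-stable; what replaces stability is the **one-excursion closure**: with `T s := s = u ∨ s = a₂ ∨ s = c`,

* **`conn_iff_off_or_excursion`**: for `x, y ∉ P`,
  `x ↔ y` iff `x ↔ y` in the outside part, or `x` reaches a terminal `s` outside, the pocket part
  joins `s` to a terminal `t`, and `t` reaches `y` outside — ONE excursion through the pocket suffices
  (two excursions collapse: either the pocket joins their terminals, or — three terminals only —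
  one of the excursions is trivial, `terminal_pigeonhole`);
* **`conn_pocket_iff`**: for `x ∉ P`, `y ∈ P`, `x ↔ y` iff `x` reaches (in the one-excursion sense) a
  terminal `s` that the pocket part joins to `y`.

These are the closure lemmas behind the twelve factorisations of the pocket (K) identity
`D·X_b = ℋ′·(P(PD, b ↔ c) − P(PD, bK))` (paper §6); the root-only case (no `c`) is
RootLeafUPocketGraph's `conn_iff_off` / `conn_b_iff`.
-/

namespace Summit.Ventures.PercRepro2

namespace RootLeafU

namespace Pocket3

variable {V : Type*} {E : Type*}

section Closure

variable {ends : E → Sym2 V} {P : Set V} {u a₂ c : V} {off inn : Config E → Config E}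

/-- The other endpoint of an open edge at a pocket vertex lies in `P ∪ {u, a₂, c}`. -/
lemma mem_or_of_openAdj (hP : ∀ e y z, ends e = s(y, z) → y ∈ P → z ∈ P ∨ z = u ∨ z = a₂ ∨ z = c)
    {ω : Config E} {y z : V} (hy : y ∈ P) (h : OpenAdj ends ω y z) :
    z ∈ P ∨ z = u ∨ z = a₂ ∨ z = c := by
  obtain ⟨e, _, hends⟩ := h
  exact hP e y z hends hy

/-- **Three terminals, four names**: if the pocket part joins `s' ~ t'` and `s ~ z` but not `t' ~ s`,
then one of the two excursions is trivial (`s' = t'` or `s = z`). -/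
lemma terminal_pigeonhole {ω : Config E} {s' t' s z : V}
    (hs' : s' = u ∨ s' = a₂ ∨ s' = c) (ht' : t' = u ∨ t' = a₂ ∨ t' = c)
    (hs : s = u ∨ s = a₂ ∨ s = c) (hz : z = u ∨ z = a₂ ∨ z = c)
    (h1 : Conn ends (inn ω) s' t') (h2 : Conn ends (inn ω) s z) (hn : ¬ Conn ends (inn ω) t' s) :
    s' = t' ∨ s = z := by
  by_contra hcon
  have hst : s' ≠ t' := fun h => hcon (Or.inl h)
  have hsz : s ≠ z := fun h => hcon (Or.inr h)
  have hn1 : s' ≠ s := by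
    intro h; subst h; exact hn (conn_symm h1)
  have hn2 : s' ≠ z := by
    intro h; subst h; exact hn (conn_trans (conn_symm h1) (conn_symm h2))
  have hn3 : t' ≠ s := by
    intro h; subst h; exact hn (conn_refl _ _ _)
  have hn4 : t' ≠ z := by
    intro h; subst h; exact hn (conn_symm h2)
  rcases hs' with rfl | rfl | rfl <;> rcases ht' with rfl | rfl | rfl <;>
    rcases hs with rfl | rfl | rfl <;> rcases hz with rfl | rfl | rfl <;> simp_all

/-- **The one-excursion closure theorem**: from `x ∉ P`, everything reached is reached outside or by
one excursion through the pocket (for `y ∉ P`), resp. by reaching a terminal in that sense and then the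
pocket part (for `y ∈ P`). -/
theorem closure (hP : ∀ e y z, ends e = s(y, z) → y ∈ P → z ∈ P ∨ z = u ∨ z = a₂ ∨ z = c)
    (hoff : (∀ ω e, e ∈ touches ends P → off ω e = false) ∧ (∀ ω e, e ∉ touches ends P → off ω e = ω e))
    (hinn : (∀ ω e, e ∈ touches ends P → inn ω e = ω e) ∧ (∀ ω e, e ∉ touches ends P → inn ω e = false))
    {ω : Config E} {x : V} (hx : x ∉ P) {y : V} (h : Conn ends ω x y) :
    (y ∉ P → (Conn ends (off ω) x y ∨ ∃ s t, (s = u ∨ s = a₂ ∨ s = c) ∧ (t = u ∨ t = a₂ ∨ t = c) ∧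
        Conn ends (off ω) x s ∧ Conn ends (inn ω) s t ∧ Conn ends (off ω) t y)) ∧
      (y ∈ P → ∃ s, (s = u ∨ s = a₂ ∨ s = c) ∧
        (Conn ends (off ω) x s ∨ ∃ s' t', (s' = u ∨ s' = a₂ ∨ s' = c) ∧ (t' = u ∨ t' = a₂ ∨ t' = c) ∧
          Conn ends (off ω) x s' ∧ Conn ends (inn ω) s' t' ∧ Conn ends (off ω) t' s) ∧
        Conn ends (inn ω) s y) := by
  let S : Set V := {y | (y ∉ P → (Conn ends (off ω) x y ∨ ∃ s t, (s = u ∨ s = a₂ ∨ s = c) ∧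
        (t = u ∨ t = a₂ ∨ t = c) ∧ Conn ends (off ω) x s ∧ Conn ends (inn ω) s t ∧ Conn ends (off ω) t y)) ∧
      (y ∈ P → ∃ s, (s = u ∨ s = a₂ ∨ s = c) ∧
        (Conn ends (off ω) x s ∨ ∃ s' t', (s' = u ∨ s' = a₂ ∨ s' = c) ∧ (t' = u ∨ t' = a₂ ∨ t' = c) ∧
          Conn ends (off ω) x s' ∧ Conn ends (inn ω) s' t' ∧ Conn ends (off ω) t' s) ∧
        Conn ends (inn ω) s y)}
  have hxS : x ∈ S := ⟨fun _ => Or.inl (conn_refl _ _ _), fun hxP => absurd hxP hx⟩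
  have hS : ∀ y ∈ S, ∀ z, (openGraph ends ω).Adj y z → z ∈ S := by
    intro y hy z hyz
    obtain ⟨_, hadj⟩ := openGraph_adj.1 hyz
    by_cases hyP : y ∈ P
    · -- `y` in the pocket: the edge survives in the pocket part
      have hin : Conn ends (inn ω) y z := conn_of_openAdj (Pocket.openAdj_inn_of_openAdj hinn hyP hadj)
      obtain ⟨s, hTs, hMs, hsy⟩ := hy.2 hyP
      have hsz : Conn ends (inn ω) s z := conn_trans hsy hin
      by_cases hzP : z ∈ P
      · exact ⟨fun h => absurd hzP h, fun _ => ⟨s, hTs, hMs, hsz⟩⟩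
      · -- `z` is a terminal: collapse the excursions
        have hTz : z = u ∨ z = a₂ ∨ z = c := by
          rcases mem_or_of_openAdj hP hyP hadj with h | h
          · exact absurd h hzP
          · exact h
        refine ⟨fun _ => Or.inr ?_, fun h => absurd h hzP⟩
        rcases hMs with hxs | ⟨s', t', hTs', hTt', hxs', hs't', ht's⟩
        · exact ⟨s, z, hTs, hTz, hxs, hsz, conn_refl _ _ _⟩
        · by_cases hjoin : Conn ends (inn ω) t' s
          · exact ⟨s', z, hTs', hTz, hxs', conn_trans hs't' (conn_trans hjoin hsz), conn_refl _ _ _⟩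
          · rcases terminal_pigeonhole hTs' hTt' hTs hTz hs't' hsz hjoin with rfl | rfl
            · exact ⟨s, z, hTs, hTz, conn_trans hxs' ht's, hsz, conn_refl _ _ _⟩
            · exact ⟨s', t', hTs', hTt', hxs', hs't', ht's⟩
    · -- `y` outside the pocket
      have hPy := hy.1 hyP
      by_cases hzP : z ∈ P
      · -- the edge enters the pocket: `y` is a terminal
        have hin : Conn ends (inn ω) y z :=
          conn_symm (conn_of_openAdj (Pocket.openAdj_inn_of_openAdj hinn hzP hadj.symm))
        have hTy : y = u ∨ y = a₂ ∨ y = c := by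
          rcases mem_or_of_openAdj hP hzP hadj.symm with h | h
          · exact absurd h hyP
          · exact h
        exact ⟨fun h => absurd hzP h, fun _ => ⟨y, hTy, hPy, hin⟩⟩
      · -- both outside: the edge survives in the outside part
        have hyz' : Conn ends (off ω) y z := conn_of_openAdj (Pocket.openAdj_off_of_openAdj hoff hyP hzP hadj)
        refine ⟨fun _ => ?_, fun h => absurd h hzP⟩
        rcases hPy with hxy | ⟨s, t, hTs, hTt, hxs, hst, hty⟩
        · exact Or.inl (conn_trans hxy hyz')
        · exact Or.inr ⟨s, t, hTs, hTt, hxs, hst, conn_trans hty hyz'⟩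
  exact mem_of_conn_of_closed hS hxS h

/-- For `x, y ∉ P`: `x ↔ y` iff outside, or by one excursion through the pocket. -/
theorem conn_iff_off_or_excursion
    (hP : ∀ e y z, ends e = s(y, z) → y ∈ P → z ∈ P ∨ z = u ∨ z = a₂ ∨ z = c)
    (hoff : (∀ ω e, e ∈ touches ends P → off ω e = false) ∧ (∀ ω e, e ∉ touches ends P → off ω e = ω e))
    (hinn : (∀ ω e, e ∈ touches ends P → inn ω e = ω e) ∧ (∀ ω e, e ∉ touches ends P → inn ω e = false))
    {ω : Config E} {x y : V} (hx : x ∉ P) (hy : y ∉ P) :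
    Conn ends ω x y ↔ Conn ends (off ω) x y ∨ ∃ s t, (s = u ∨ s = a₂ ∨ s = c) ∧ (t = u ∨ t = a₂ ∨ t = c) ∧
      Conn ends (off ω) x s ∧ Conn ends (inn ω) s t ∧ Conn ends (off ω) t y := by
  constructor
  · intro h
    exact (closure hP hoff hinn hx h).1 hy
  · rintro (h | ⟨s, t, _, _, hxs, hst, hty⟩)
    · exact conn_mono (Pocket.off_le hoff ω) h
    · exact conn_trans (conn_mono (Pocket.off_le hoff ω) hxs)
        (conn_trans (conn_mono (Pocket.inn_le hinn ω) hst) (conn_mono (Pocket.off_le hoff ω) hty))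

/-- For `x ∉ P`, `y ∈ P`: `x ↔ y` iff `x` reaches a terminal `s` (outside or by one excursion) and the
pocket part joins `s` to `y`. -/
theorem conn_pocket_iff
    (hP : ∀ e y z, ends e = s(y, z) → y ∈ P → z ∈ P ∨ z = u ∨ z = a₂ ∨ z = c)
    (hoff : (∀ ω e, e ∈ touches ends P → off ω e = false) ∧ (∀ ω e, e ∉ touches ends P → off ω e = ω e))
    (hinn : (∀ ω e, e ∈ touches ends P → inn ω e = ω e) ∧ (∀ ω e, e ∉ touches ends P → inn ω e = false))
    {ω : Config E} {x y : V} (hx : x ∉ P) (hy : y ∈ P) :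
    Conn ends ω x y ↔ ∃ s, (s = u ∨ s = a₂ ∨ s = c) ∧
      (Conn ends (off ω) x s ∨ ∃ s' t', (s' = u ∨ s' = a₂ ∨ s' = c) ∧ (t' = u ∨ t' = a₂ ∨ t' = c) ∧
        Conn ends (off ω) x s' ∧ Conn ends (inn ω) s' t' ∧ Conn ends (off ω) t' s) ∧
      Conn ends (inn ω) s y := by
  constructor
  · intro h
    exact (closure hP hoff hinn hx h).2 hy
  · rintro ⟨s, _, hM, hsy⟩
    have hxs : Conn ends ω x s := by
      rcases hM with h | ⟨s', t', _, _, hxs', hs't', ht's⟩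
      · exact conn_mono (Pocket.off_le hoff ω) h
      · exact conn_trans (conn_mono (Pocket.off_le hoff ω) hxs')
          (conn_trans (conn_mono (Pocket.inn_le hinn ω) hs't') (conn_mono (Pocket.off_le hoff ω) ht's))
    exact conn_trans hxs (conn_mono (Pocket.inn_le hinn ω) hsy)

end Closure

end Pocket3

end RootLeafU

end Summit.Ventures.PercRepro2
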